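import Summits.QuantumFields.YangMills.Theorems.UnitScaleTiltProp7CovAgmonInterp
import Summits.QuantumFields.YangMills.Theorems.UnitScaleTiltProp7CovariantActionHS
import HarnessLib

/-!
# Route `UnitScaleTilt`, crux K1 «MinimiserStabilityRegPr» (stmt-QuantumFields-19200), route-R E′ path (α′), (E1-b) covariant, row (hK₂-cov) — LEMMA (C1):
# THE COVARIANT CACCIOPPOLI INEQUALITY WITH AN ARBITRARY REAL CUTOFF (punctured balls included) —
# `Σ_x ψ(x)²·Σ_μ hs(D_μV(x)) ≤ Σ_xΣ_μ (ψ(x+e_μ) − ψ(x))²·(2·hs V(x) + 7·hs V(x+e_μ))` whenever `Δ_UV = 0` on `{ψ ≠ 0}`, unitary background, NO weight positivity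

Cell `ym3-torus`, width seat `ym3-torus-px11` (gen 3), LEAD of the (hK₂-cov) chain (routeR-w3 g6 WORDS (8)–(10), 2026-08-28T21:58:57Z); LOCATE 19200 evidence #57
`LOCATE-HK2COV-px11g3.md` §1 (C1).  `--kind proof --supports stmt-QuantumFields-19200 --as helper`, count-neutral.  THEOREMS ONLY (0 `def`, 0 `sorry`).
YM₃ on T³ is a ladder rung (R3) — not d = 4, not infinite volume, not a mass gap, not the Clay problem; nothing here claims the stub, the crux or the gap.

THE POINT.  The (Q)∕(PIN) rows of (hK₂-cov) run px7's flat texts on the FRAMED field `v = R(Fr⁻¹)V` (`V := Δ_Uφ_H`, covariantly harmonic off the centres) and pay the frame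
junk `f = Δ_h v − Δ₁v` (`‖f‖ ≲ τ₁‖∂v‖ + (τ₂ + τ₁²)‖v‖`) in `L¹` near a pin; the first-difference term is controlled by an `s²`-WEIGHTED gradient energy on the PUNCTURED pin ball,
`Σ_{0<s<R} s²·hs(D_UV) ≲ Σ_{s<2R} hs(V)` — a Caccioppoli inequality whose cutoff VANISHES AT THE PIN (killing the pin's delta) and outside the `2R`-ball.  The tree's weighted
gradient inequality ✓ `Prop7CovAgmonInterp.weighted_covGrad_sq_le` needs a POSITIVE weight with small RELATIVE rows (Agmon); this file is its absolute-difference sibling for ANY real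
cutoff `ψ`: Green ✓ `sum_sum_covD_mul` with `w = ψ²•V` (the pairing `Σ⟨Δ_UV, ψ²V⟩` vanishes identically since `Δ_UV = 0` wherever `ψ ≠ 0`), Leibniz with the weight at the bond
source ✓ `covD_smul_fun_src`, `ψ₊² − ψ² = (ψ₊−ψ)(2ψ + (ψ₊−ψ))`, Cauchy–Schwarz ✓ `abs_re_trace_le_sqrt_mul_sqrt`, `hs(R(U)X) = hs X` ✓ `sum_norm_sq_R`, absorb `½Σψ²hs(DV)`.

WHAT IS PROVED (ns `…Theorems.Prop7CovPuncturedCaccioppoli`; torus `Site P i`, unitary `U`, `hs X = Σ_{jk}‖X_jk‖²`, η-short `Δ_UV x := divB T U (fun μ => covD T U μ V) x`).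
* §1 `hs_covD_le` (`hs(D_μV x) ≤ 2hs V(x) + 2hs V(x+e_μ)`), `re_trace_covLaplace_smul_self_eq_zero` (the vanishing pairing).
* §2 ★★ `sum_sq_mul_hs_covD_le` — the inequality of the title, any real `ψ`, hypothesis `∀ x, ψ x ≠ 0 → Δ_UV x = 0`.
* §3 ★★ `sum_sq_mul_hs_covD_le_of_support` — the consumer's form: if `|ψ(x+e_μ) − ψ x| ≤ 1`, every bond where `ψ` changes starts in `S`, and `S` plus one forward step lies in `S′`,
  then `Σ_x ψ²·Σ_μ hs(D_μV) ≤ 9d·Σ_{x∈S′} hs V(x)` (take `ψ :=` the tent `min(s, 2R − s)₊` in `s = tdist(·,y₀′)`: `ψ ≥ s` is false but `ψ = s` on `s ≤ R`, so the left side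
  dominates `Σ_{0<s≤R} s²·Σ_μ hs(D_μV)`, and `S′ =` the `(2R+1)`-ball).
HONEST SCOPE.  [folklore] (Caccioppoli 1951 ∕ [Giaquinta1984] Ch. III, lattice∕covariant reading); nothing of Bałaban's is asserted; the (Q)∕(PIN) rows themselves are F3-cov.

References: M. Giaquinta, Princeton UP 1983 [Giaquinta1984] (Ch. III §1 Thm 1.2 p.70); T. Bałaban, CMP 99 (1985) 389–434 [Balaban1985BackgroundPropagators] ((3.3), (3.8) pp.390–392).
-/

set_option autoImplicit false

noncomputable section

open scoped BigOperators Matrix.Norms.L2Operator Matrix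

namespace Summit.QuantumFields.YangMills.Theorems.Prop7CovPuncturedCaccioppoli

open Literature.MathematicalPhysics.QuantumFieldTheory.Balaban1983to89
open B9Eq39Adjoint (R covD covDstar divB sum_sum_covD_mul)
open B9TorusCalculus (torusT torusT_apply torusT_symm_apply)
open Summit.QuantumFields.YangMills.Theorems.Prop7CovariantCoercivity (sum_norm_sq_R sum_norm_sq_sub_le conjTranspose_covD re_trace_conjTranspose_mul_self re_trace_mul_comm)
open Summit.QuantumFields.YangMills.Theorems.Prop7CovInterpKernelDual (abs_re_trace_le_sqrt_mul_sqrt sum_re_trace_covLaplace_comm)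
open Summit.QuantumFields.YangMills.Theorems.Prop7CovAgmonLetters (hs_smul covD_smul_fun_src)
open Summit.QuantumFields.YangMills.Theorems.Prop7CovAgmonInterp (re_trace_conjTranspose_mul_smul)

variable {P : Params} {i : ℕ} {N : ℕ}

/-! ## §1 Hilbert–Schmidt letters -/

section Letters

variable {U : Fin P.d → Site P i → (Matrix (Fin N) (Fin N) ℂ)ˣ}

/-- `hs((D_{U,μ}V)(x)) ≤ 2·hs V(x) + 2·hs V(x+e_μ)` at a unitary background (`D_μV(x) = R(U_μ x)V(x+e_μ) − V(x)`, `hs(R(u)X) = hs X`).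
[cite: Balaban1985BackgroundPropagators, (3.3) p.390] -/
theorem hs_covD_le (hU : ∀ ν x, (U ν x : Matrix (Fin N) (Fin N) ℂ) ∈ unitary (Matrix (Fin N) (Fin N) ℂ))
    (V : Site P i → Matrix (Fin N) (Fin N) ℂ) (μ : Fin P.d) (x : Site P i) :
    ∑ j : Fin N, ∑ k : Fin N, ‖(covD (torusT P i) U μ V x) j k‖ ^ 2
      ≤ 2 * ∑ j : Fin N, ∑ k : Fin N, ‖(V x) j k‖ ^ 2 + 2 * ∑ j : Fin N, ∑ k : Fin N, ‖(V (x.shift μ)) j k‖ ^ 2 := by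
  have h := sum_norm_sq_sub_le (R (U μ x) (V (x.shift μ))) (V x)
  rw [sum_norm_sq_R (hU μ x)] at h
  simp only [covD, torusT_apply]
  linarith

/-- The pairing `⟨Δ_UV(x), ψ(x)²•V(x)⟩` VANISHES at every site when `Δ_UV = 0` on `{ψ ≠ 0}` (the punctured-harmonic hypothesis). [folklore] -/
theorem re_trace_covLaplace_smul_self_eq_zero (ψ : Site P i → ℝ) (V : Site P i → Matrix (Fin N) (Fin N) ℂ)
    (hV : ∀ x, ψ x ≠ 0 → divB (torusT P i) U (fun μ => covD (torusT P i) U μ V) x = 0) (x : Site P i) :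
    (((divB (torusT P i) U (fun μ => covD (torusT P i) U μ V) x)ᴴ * ((ψ x ^ 2) • V x)).trace).re = 0 := by
  by_cases hψ : ψ x = 0
  · rw [hψ]; simp
  · rw [hV x hψ]; simp

end Letters

/-! ## §2 ★★ The covariant Caccioppoli inequality with an arbitrary real cutoff -/

section Caccioppoli

variable {U : Fin P.d → Site P i → (Matrix (Fin N) (Fin N) ℂ)ˣ}

/-- ★★ **COVARIANT CACCIOPPOLI, ARBITRARY REAL CUTOFF** (unitary background): if `Δ_UV(x) = 0` wherever `ψ(x) ≠ 0`, then
`Σ_x ψ(x)²·Σ_μ hs(D_μV(x)) ≤ Σ_xΣ_μ (ψ(x+e_μ) − ψ(x))²·(2·hs V(x) + 7·hs V(x+e_μ))`.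
No positivity or relative smallness of `ψ` is assumed — the cutoff may vanish at a pin and outside a ball (punctured Caccioppoli).
(Green ✓ `sum_sum_covD_mul` with `ψ²•V`; Leibniz at the source ✓ `covD_smul_fun_src`; `ψ₊² − ψ² = (ψ₊−ψ)(2ψ + (ψ₊−ψ))`; Cauchy–Schwarz; `hs(D_μV) ≤ 2hs V + 2hs V₊` (✓ `sum_norm_sq_sub_le`); absorb.)
[folklore] [cite: Giaquinta1984, Ch. III §1 Thm 1.2 p.70; Balaban1985BackgroundPropagators, (3.8) p.392] -/
theorem sum_sq_mul_hs_covD_le (hU : ∀ ν x, (U ν x : Matrix (Fin N) (Fin N) ℂ) ∈ unitary (Matrix (Fin N) (Fin N) ℂ))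
    (ψ : Site P i → ℝ) (V : Site P i → Matrix (Fin N) (Fin N) ℂ)
    (hV : ∀ x, ψ x ≠ 0 → divB (torusT P i) U (fun μ => covD (torusT P i) U μ V) x = 0) :
    ∑ x : Site P i, ∑ μ : Fin P.d, ψ x ^ 2 * ∑ j : Fin N, ∑ k : Fin N, ‖(covD (torusT P i) U μ V x) j k‖ ^ 2
      ≤ ∑ x : Site P i, ∑ μ : Fin P.d, (ψ (x.shift μ) - ψ x) ^ 2 *
          (2 * ∑ j : Fin N, ∑ k : Fin N, ‖(V x) j k‖ ^ 2 + 7 * ∑ j : Fin N, ∑ k : Fin N, ‖(V (x.shift μ)) j k‖ ^ 2) := by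
  classical
  set τ := Complex.reAddGroupHom.comp (Matrix.traceAddMonoidHom (Fin N) ℂ) with hτ
  have hτa : ∀ A : Matrix (Fin N) (Fin N) ℂ, τ A = (A.trace).re := fun A => by simp [hτ]
  set G2 := ∑ x : Site P i, ∑ μ : Fin P.d, ψ x ^ 2 * ∑ j : Fin N, ∑ k : Fin N, ‖(covD (torusT P i) U μ V x) j k‖ ^ 2 with hG2
  -- the weighted field
  set v : Site P i → Matrix (Fin N) (Fin N) ℂ := fun z => (ψ z ^ 2) • V z with hv
  have hLeib : ∀ x μ, covD (torusT P i) U μ v x = (ψ x ^ 2) • covD (torusT P i) U μ V x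
      + (ψ (torusT P i μ x) ^ 2 - ψ x ^ 2) • R (U μ x) (V (torusT P i μ x)) := fun x μ => covD_smul_fun_src U (fun z => ψ z ^ 2) V μ x
  -- STEP 1: `G2 = Σ⟨D V, D v⟩ − Σ⟨D V, (ψ₊² − ψ²)•R(U)V₊⟩`
  have hstep1 : G2 = ∑ x : Site P i, ∑ μ : Fin P.d, (((covD (torusT P i) U μ V x)ᴴ * covD (torusT P i) U μ v x).trace).re
      - ∑ x : Site P i, ∑ μ : Fin P.d, (((covD (torusT P i) U μ V x)ᴴ
          * ((ψ (torusT P i μ x) ^ 2 - ψ x ^ 2) • R (U μ x) (V (torusT P i μ x)))).trace).re := by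
    rw [← Finset.sum_sub_distrib, hG2]
    refine Finset.sum_congr rfl fun x _ => ?_
    rw [← Finset.sum_sub_distrib]
    refine Finset.sum_congr rfl fun μ _ => ?_
    rw [hLeib, mul_add, Matrix.trace_add, Complex.add_re, add_sub_cancel_right, re_trace_conjTranspose_mul_smul, re_trace_conjTranspose_mul_self]
  -- STEP 2: Green, and the pairing with `Δ_UV` vanishes
  have hgreen : ∑ x : Site P i, ∑ μ : Fin P.d, (((covD (torusT P i) U μ V x)ᴴ * covD (torusT P i) U μ v x).trace).re = 0 := by
    have h := sum_sum_covD_mul (torusT P i) U τ re_trace_mul_comm (fun z => (V z)ᴴ) (fun μ => covD (torusT P i) U μ v)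
    have hl : ∑ x : Site P i, ∑ μ : Fin P.d, τ (covD (torusT P i) U μ (fun z => (V z)ᴴ) x * covD (torusT P i) U μ v x)
        = ∑ x : Site P i, ∑ μ : Fin P.d, (((covD (torusT P i) U μ V x)ᴴ * covD (torusT P i) U μ v x).trace).re :=
      Finset.sum_congr rfl fun x _ => Finset.sum_congr rfl fun μ _ => by rw [← conjTranspose_covD hU, hτa]
    rw [← hl, h, Finset.sum_congr rfl fun x _ => hτa _, ← sum_re_trace_covLaplace_comm hU V v]
    exact Finset.sum_eq_zero fun x _ => re_trace_covLaplace_smul_self_eq_zero ψ V hV x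
  -- STEP 3: the remainder, pointwise
  have hpt : ∀ x μ, |(((covD (torusT P i) U μ V x)ᴴ * ((ψ (torusT P i μ x) ^ 2 - ψ x ^ 2) • R (U μ x) (V (torusT P i μ x)))).trace).re|
      ≤ 1 / 2 * (ψ x ^ 2 * ∑ j : Fin N, ∑ k : Fin N, ‖(covD (torusT P i) U μ V x) j k‖ ^ 2)
        + (ψ (x.shift μ) - ψ x) ^ 2 * (∑ j : Fin N, ∑ k : Fin N, ‖(V x) j k‖ ^ 2 + 7 / 2 * ∑ j : Fin N, ∑ k : Fin N, ‖(V (x.shift μ)) j k‖ ^ 2) := by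
    intro x μ
    simp only [torusT_apply]
    rw [re_trace_conjTranspose_mul_smul, abs_mul]
    have hcs := abs_re_trace_le_sqrt_mul_sqrt (covD (torusT P i) U μ V x) (R (U μ x) (V (x.shift μ)))
    rw [sum_norm_sq_R (hU μ x)] at hcs
    set A := ∑ j : Fin N, ∑ k : Fin N, ‖(covD (torusT P i) U μ V x) j k‖ ^ 2 with hA
    set B := ∑ j : Fin N, ∑ k : Fin N, ‖(V (x.shift μ)) j k‖ ^ 2 with hB
    set H := ∑ j : Fin N, ∑ k : Fin N, ‖(V x) j k‖ ^ 2 with hH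
    have hA0 : 0 ≤ A := Finset.sum_nonneg fun _ _ => Finset.sum_nonneg fun _ _ => sq_nonneg _
    have hB0 : 0 ≤ B := Finset.sum_nonneg fun _ _ => Finset.sum_nonneg fun _ _ => sq_nonneg _
    have hH0 : 0 ≤ H := Finset.sum_nonneg fun _ _ => Finset.sum_nonneg fun _ _ => sq_nonneg _
    have hAH : A ≤ 2 * H + 2 * B := hs_covD_le hU V μ x
    have hAA : Real.sqrt A * Real.sqrt A = A := Real.mul_self_sqrt hA0
    have hBB : Real.sqrt B * Real.sqrt B = B := Real.mul_self_sqrt hB0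
    set a := Real.sqrt A with ha
    set b := Real.sqrt B with hb
    have ha0 : 0 ≤ a := Real.sqrt_nonneg _
    have hb0 : 0 ≤ b := Real.sqrt_nonneg _
    set δ := ψ (x.shift μ) - ψ x with hδ
    -- `|ψ₊² − ψ²| = |δ|·|ψ₊ + ψ| ≤ |δ|·(2|ψ| + |δ|)`
    have hfac : |ψ (x.shift μ) ^ 2 - ψ x ^ 2| ≤ |δ| * (2 * |ψ x| + |δ|) := by
      have e : ψ (x.shift μ) ^ 2 - ψ x ^ 2 = δ * (2 * ψ x + δ) := by rw [hδ]; ring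
      rw [e, abs_mul]
      refine mul_le_mul_of_nonneg_left ((abs_add_le _ _).trans (le_of_eq ?_)) (abs_nonneg _)
      rw [abs_mul, abs_two]
    have hre0 : 0 ≤ |(((covD (torusT P i) U μ V x)ᴴ * R (U μ x) (V (x.shift μ))).trace).re| := abs_nonneg _
    have h1 : |ψ (x.shift μ) ^ 2 - ψ x ^ 2| * |(((covD (torusT P i) U μ V x)ᴴ * R (U μ x) (V (x.shift μ))).trace).re|
        ≤ (|δ| * (2 * |ψ x| + |δ|)) * (a * b) := mul_le_mul hfac hcs hre0 (by positivity)
    -- `2|ψ||δ|ab ≤ ½ψ²a² + 2δ²b²` and `δ²ab ≤ δ²(a²+b²)∕2 ≤ δ²(H + 3B∕2)`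
    have hψ2 : |ψ x| ^ 2 = ψ x ^ 2 := sq_abs _
    have hδ2 : |δ| ^ 2 = δ ^ 2 := sq_abs _
    have key : (|δ| * (2 * |ψ x| + |δ|)) * (a * b) ≤ 1 / 2 * (ψ x ^ 2 * A) + δ ^ 2 * (H + 7 / 2 * B) := by
      nlinarith [sq_nonneg (|ψ x| * a - 2 * (|δ| * b)), sq_nonneg (a - b), hAA, hBB, hAH, abs_nonneg δ, abs_nonneg (ψ x),
        mul_nonneg (sq_nonneg δ) hB0, mul_nonneg (sq_nonneg δ) hH0, hψ2, hδ2, mul_nonneg (abs_nonneg δ) (abs_nonneg δ)]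
    exact h1.trans key
  -- sum the pointwise bound
  have hrem : -(∑ x : Site P i, ∑ μ : Fin P.d, (((covD (torusT P i) U μ V x)ᴴ
          * ((ψ (torusT P i μ x) ^ 2 - ψ x ^ 2) • R (U μ x) (V (torusT P i μ x)))).trace).re)
      ≤ 1 / 2 * G2 + ∑ x : Site P i, ∑ μ : Fin P.d, (ψ (x.shift μ) - ψ x) ^ 2 *
          (∑ j : Fin N, ∑ k : Fin N, ‖(V x) j k‖ ^ 2 + 7 / 2 * ∑ j : Fin N, ∑ k : Fin N, ‖(V (x.shift μ)) j k‖ ^ 2) := by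
    rw [hG2, Finset.mul_sum, ← Finset.sum_add_distrib, ← Finset.sum_neg_distrib]
    refine Finset.sum_le_sum fun x _ => ?_
    rw [Finset.mul_sum, ← Finset.sum_add_distrib, ← Finset.sum_neg_distrib]
    refine Finset.sum_le_sum fun μ _ => ?_
    exact (neg_le_abs _).trans (hpt x μ)
  -- COMBINE
  have hG : G2 ≤ 1 / 2 * G2 + ∑ x : Site P i, ∑ μ : Fin P.d, (ψ (x.shift μ) - ψ x) ^ 2 *
          (∑ j : Fin N, ∑ k : Fin N, ‖(V x) j k‖ ^ 2 + 7 / 2 * ∑ j : Fin N, ∑ k : Fin N, ‖(V (x.shift μ)) j k‖ ^ 2) := by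
    linarith [hstep1, hgreen, hrem]
  have hfin : G2 ≤ 2 * ∑ x : Site P i, ∑ μ : Fin P.d, (ψ (x.shift μ) - ψ x) ^ 2 *
          (∑ j : Fin N, ∑ k : Fin N, ‖(V x) j k‖ ^ 2 + 7 / 2 * ∑ j : Fin N, ∑ k : Fin N, ‖(V (x.shift μ)) j k‖ ^ 2) := by linarith
  refine hfin.trans (le_of_eq ?_)
  rw [Finset.mul_sum]
  refine Finset.sum_congr rfl fun x _ => ?_
  rw [Finset.mul_sum]
  refine Finset.sum_congr rfl fun μ _ => ?_
  ring

/-! ## §3 The consumer's form: Lipschitz cutoff supported near a set -/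

/-- ★★ **COVARIANT CACCIOPPOLI, SUPPORT FORM**: `Δ_UV = 0` on `{ψ ≠ 0}`, `|ψ(x+e_μ) − ψ(x)| ≤ 1` on every bond, every bond along which `ψ` changes starts in `S`, and `S`
together with its forward neighbours lies in `S′` ⇒ `Σ_x ψ(x)²·Σ_μ hs(D_μV(x)) ≤ 9d·Σ_{x∈S′} hs V(x)`.  (For the tent `ψ = min(s, 2R − s)₊`, `s = tdist(·,y₀′)`, of a pin
`y₀′`: the left side dominates `Σ_{0<s≤R} s²·Σ_μ hs(D_μV)` and `S′` is the `(2R+1)`-ball — the `s²`-weighted gradient energy on the punctured pin ball is at most `9d` times the mass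
on the doubled ball.) [folklore] [cite: Giaquinta1984, Ch. III §1 Thm 1.2 p.70; Balaban1985BackgroundPropagators, (3.8) p.392] -/
theorem sum_sq_mul_hs_covD_le_of_support (hU : ∀ ν x, (U ν x : Matrix (Fin N) (Fin N) ℂ) ∈ unitary (Matrix (Fin N) (Fin N) ℂ))
    (ψ : Site P i → ℝ) (V : Site P i → Matrix (Fin N) (Fin N) ℂ)
    (hV : ∀ x, ψ x ≠ 0 → divB (torusT P i) U (fun μ => covD (torusT P i) U μ V) x = 0)
    (hlip : ∀ x μ, |ψ (x.shift μ) - ψ x| ≤ 1)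
    (S S' : Finset (Site P i)) (hS : ∀ x μ, ψ (x.shift μ) - ψ x ≠ 0 → x ∈ S) (hSS' : S ⊆ S') (hstep : ∀ x ∈ S, ∀ μ, x.shift μ ∈ S') :
    ∑ x : Site P i, ∑ μ : Fin P.d, ψ x ^ 2 * ∑ j : Fin N, ∑ k : Fin N, ‖(covD (torusT P i) U μ V x) j k‖ ^ 2
      ≤ 9 * P.d * ∑ x ∈ S', ∑ j : Fin N, ∑ k : Fin N, ‖(V x) j k‖ ^ 2 := by
  classical
  set hsV : Site P i → ℝ := fun x => ∑ j : Fin N, ∑ k : Fin N, ‖(V x) j k‖ ^ 2 with hhsV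
  have hs0 : ∀ x, 0 ≤ hsV x := fun x => Finset.sum_nonneg fun _ _ => Finset.sum_nonneg fun _ _ => sq_nonneg _
  refine (sum_sq_mul_hs_covD_le hU ψ V hV).trans ?_
  -- each summand is `≤ 𝟙_S(x)·(2hsV x + 7hsV(x+μ))`
  have hterm : ∀ x μ, (ψ (x.shift μ) - ψ x) ^ 2 * (2 * hsV x + 7 * hsV (x.shift μ))
      ≤ (if x ∈ S then 2 * hsV x + 7 * hsV (x.shift μ) else 0) := by
    intro x μ
    by_cases hx : x ∈ S
    · rw [if_pos hx]
      have hd1 : (ψ (x.shift μ) - ψ x) ^ 2 ≤ 1 := by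
        have h := hlip x μ
        have h2 : (ψ (x.shift μ) - ψ x) ^ 2 = |ψ (x.shift μ) - ψ x| ^ 2 := (sq_abs _).symm
        rw [h2]; nlinarith [abs_nonneg (ψ (x.shift μ) - ψ x)]
      have hpos : 0 ≤ 2 * hsV x + 7 * hsV (x.shift μ) := by linarith [hs0 x, hs0 (x.shift μ)]
      calc (ψ (x.shift μ) - ψ x) ^ 2 * (2 * hsV x + 7 * hsV (x.shift μ)) ≤ 1 * (2 * hsV x + 7 * hsV (x.shift μ)) :=
            mul_le_mul_of_nonneg_right hd1 hpos
        _ = _ := one_mul _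
    · rw [if_neg hx]
      have h0 : ψ (x.shift μ) - ψ x = 0 := by
        by_contra h; exact hx (hS x μ h)
      rw [h0]; simp
  have hsum1 : ∑ x : Site P i, ∑ μ : Fin P.d, (ψ (x.shift μ) - ψ x) ^ 2 * (2 * hsV x + 7 * hsV (x.shift μ))
      ≤ ∑ x ∈ S, ∑ μ : Fin P.d, (2 * hsV x + 7 * hsV (x.shift μ)) := by
    calc ∑ x : Site P i, ∑ μ : Fin P.d, (ψ (x.shift μ) - ψ x) ^ 2 * (2 * hsV x + 7 * hsV (x.shift μ))
        ≤ ∑ x : Site P i, ∑ μ : Fin P.d, (if x ∈ S then 2 * hsV x + 7 * hsV (x.shift μ) else 0) :=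
          Finset.sum_le_sum fun x _ => Finset.sum_le_sum fun μ _ => hterm x μ
      _ = ∑ x : Site P i, (if x ∈ S then ∑ μ : Fin P.d, (2 * hsV x + 7 * hsV (x.shift μ)) else 0) :=
          Finset.sum_congr rfl fun x _ => by split_ifs <;> simp
      _ = ∑ x ∈ S, ∑ μ : Fin P.d, (2 * hsV x + 7 * hsV (x.shift μ)) := by
          rw [Finset.sum_ite_mem, Finset.univ_inter]
  -- `Σ_{x∈S} hsV x ≤ Σ_{S′}` and `Σ_{x∈S} hsV(x+μ) ≤ Σ_{S′}` (the shift is injective)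
  have hA : ∑ x ∈ S, hsV x ≤ ∑ x ∈ S', hsV x := Finset.sum_le_sum_of_subset_of_nonneg hSS' fun x _ _ => hs0 x
  have hB : ∀ μ : Fin P.d, ∑ x ∈ S, hsV (x.shift μ) ≤ ∑ x ∈ S', hsV x := by
    intro μ
    have hinj : Set.InjOn (fun x : Site P i => x.shift μ) S := fun x _ y _ h => by
      simpa using congrArg (fun z : Site P i => z.unshift μ) h
    rw [← Finset.sum_image (f := hsV) hinj]
    refine Finset.sum_le_sum_of_subset_of_nonneg (fun y hy => ?_) fun x _ _ => hs0 x
    obtain ⟨x, hx, rfl⟩ := Finset.mem_image.1 hy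
    exact hstep x hx μ
  have hsum2 : ∑ x ∈ S, ∑ μ : Fin P.d, (2 * hsV x + 7 * hsV (x.shift μ)) ≤ 9 * P.d * ∑ x ∈ S', hsV x := by
    rw [Finset.sum_comm]
    have hμ : ∀ μ : Fin P.d, ∑ x ∈ S, (2 * hsV x + 7 * hsV (x.shift μ)) ≤ 9 * ∑ x ∈ S', hsV x := by
      intro μ
      rw [Finset.sum_add_distrib, ← Finset.mul_sum, ← Finset.mul_sum]
      linarith [hA, hB μ]
    calc ∑ μ : Fin P.d, ∑ x ∈ S, (2 * hsV x + 7 * hsV (x.shift μ)) ≤ ∑ _μ : Fin P.d, 9 * ∑ x ∈ S', hsV x := Finset.sum_le_sum fun μ _ => hμ μ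
      _ = 9 * P.d * ∑ x ∈ S', hsV x := by rw [Finset.sum_const, Finset.card_univ, Fintype.card_fin, nsmul_eq_mul]; ring
  exact hsum1.trans hsum2

end Caccioppoli

end Summit.QuantumFields.YangMills.Theorems.Prop7CovPuncturedCaccioppoli

end
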